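import Literature.AlgebraicGeometry.ComplexMultiplication.EndomorphismFieldCMType
import HarnessLib

/-!
# `A ∼ B^{[F:K₀]}` and the Hodge conjecture for a pair `(A, ι)` whose type is induced from a (quadratic) CM subfield

Topic `Literature/AlgebraicGeometry/ComplexMultiplication` (family `hodge`, lane `lit-hodgefound`; Shimura 1998
§6.2 THEOREM 3 and van Geemen 1994 Thm. 4.3 on the ALGEBRAIC carrier `Motives.AbelianVariety ℂ`).  Sequel of
`EndomorphismFieldCMType` (THE type `cmTypeOfPair ι hF` of a pair `(A, ι : F →+* A.endAlgebra)`,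
`[F : ℚ] = 2 dim A`, is the type read by Shimura's analytic representation on any uniformising torus) and of
`CMAbelianVarietyIsogenousPower` (§6.2 THEOREM 3 «`A ∼ B × ⋯ × B`» for `A^an = ℂ^Φ/D(𝔞)`, and the Hodge
conjecture when `Φ` is induced from an imaginary quadratic field — there under lattice / `IsCMTorus`
hypotheses).  Here the hypotheses are INTRINSIC: Shimura's pair `(A, ι)` and THE type `cmTypeOfPair ι hF`.

PRINTED STATEMENTS.  [Shimura1998] §6.2 THEOREM 3 with its proof (pp. 42–44, held chunk p0054 L3–L5, p0056
L1): for `Φ = {φᵢ}` induced from a CM type `(K; {ψⱼ})` of a CM subfield `K ≤ F`, `[F : K] = h`, «`ℂⁿ/D(𝔪)` is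
complex analytically isomorphic to the direct product of `h` copies of `ℂ^m/Δ`», so with §6.1 COROLLARY every
`(A, ι)` of type `(F; {φᵢ})` is isogenous to `B^h`, `B` of type `(K; {ψⱼ})`; [vanGeemen1994HodgeAV] Thm. 4.3
(with Lemma 3.7): the Hodge conjecture holds for every complex abelian variety isogenous to a power of an
elliptic curve.

WHAT IS PROVED (`ιF : F →+* A.endAlgebra`, `hF : finrank ℚ F = 2 * A.dim`, `K₀ ≤ F` a CM subfield,
`Φ₀ : CMType K₀` with `inducedCMType (algebraMap K₀ F) Φ₀ = cmTypeOfPair ιF hF`):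
* §1 **`isIsogenous_powSucc_varietyOfIdeal`** — THEOREM 3 + §6.1 Cor. on the algebraic carrier with intrinsic
  hypotheses: `A ∼ B^{[F:K₀]}` (both directions) for the CM abelian variety of record `B = varietyOfIdeal Φ₀ 1`
  (`B^an = ℂ^{Φ₀}/D(𝔬_{K₀})`), and `dim A = [F : K₀] · dim B`;
* §2 (`[K₀ : ℚ] = 2`) **`hodgeConjectureFor_of_inducedCMType_eq_cmTypeOfPair`** — THE HODGE CONJECTURE, in
  every codimension, for every complex abelian variety `A` whose `End_ℚ(A)` contains a field `F` of degree
  `2 dim A` such that the type of `(A, F)` is induced from an imaginary quadratic subfield `K₀ ≤ F`: then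
  `A ∼ E^{dim A}` for the CM elliptic curve `E = ℂ/𝔬_{K₀}` (`exists_ellipticCurve_isIsogenous_powSucc`,
  `End⁰(E) ≅ K₀`) and van Geemen's Thm. 4.3 (the tree's `EllipticCurve.hodgeConjectureFor_of_isIsogenous_powSucc`)
  applies; `hodgeConjectureFor_of_isIsogenous_of_inducedCMType` for everything isogenous to such an `A`.
  A KNOWN case of the Hodge conjecture (Tate, Murasaki, van Geemen); nothing here bears on the open cases.
* §3 **`exists_inducedCMType_eq_iff_forall_comp_eq`** — a CM type of `F` is induced from a QUADRATIC subfield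
  `K₀` iff all its members agree on `K₀` (so the hypothesis of §2 is checkable on THE type);
  `hodgeConjectureFor_of_forall_comp_eq`.

Theorems only (one private folklore lemma: an imaginary quadratic field is a CM field); no definition, no named
fact, no `sorry` (net debt 0); axioms `propext`, `Classical.choice`, `Quot.sound`.

## References
* [Shimura1998] G. Shimura, *Abelian Varieties with Complex Multiplication and Modular Functions* (1998), §6.1
  Thm. 2 with Cor. (p. 41), §6.2 Thm. 3 with proof (pp. 42–44).
* [vanGeemen1994HodgeAV] B. van Geemen, *An introduction to the Hodge conjecture for abelian varieties*, LNM 1594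
  (1994), Lemma 3.7, Thm. 4.3.
* [Gordon1997] B. B. Gordon, *A survey of the Hodge conjecture for abelian varieties* (1997), §3.
-/

noncomputable section

namespace Literature.AlgebraicGeometry.ComplexMultiplication

open scoped Manifold ContDiff Classical nonZeroDivisors
open CategoryTheory NumberField Module
open Literature.AlgebraicGeometry.Motives
open Literature.AlgebraicGeometry.HodgeTheory
open Literature.Geometry.Kaehler (ComplexTorus)
open Literature.NumberTheory.Transcendental (IsAnalytification)
open Literature.NumberTheory.ComplexMultiplication
open Literature.NumberTheory.ComplexMultiplication.CMTypeLattice (periodIso)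

namespace EndFieldFullDegree

variable {F : Type} [Field F] [NumberField F] {A : AbelianVariety ℂ}
  (ιF : F →+* A.endAlgebra) (hF : finrank ℚ F = 2 * A.dim)
  {K₀ : IntermediateField ℚ F} {Φ₀ : CMType K₀}

/-! ### §1 THEOREM 3 + §6.1 COROLLARY with intrinsic hypotheses: `A ∼ B^{[F:K₀]}` -/

section InducedType

variable [IsCMField K₀] (hΦ : inducedCMType (algebraMap K₀ F) Φ₀ = cmTypeOfPair ιF hF)

omit [IsCMField K₀] in
include hΦ in
/-- **`A^an ∼ (ℂ^{Φ₀}/D(𝔬_{K₀}))^{[F:K₀]}` for every torus analytifying `A`**, when THE type of `(A, ι)` is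
`Φ₀^F`: `X ∼ ℂ^Φ/D(𝔬_F)` (THEOREM 2 + §6.1 Cor., `isIsogenous_periodIso_cmTypeOfPair`) and
`ℂ^Φ/D(𝔬_F) ∼ (ℂ^{Φ₀}/D(𝔬_{K₀}))^h` (the proof of THEOREM 3, `CMTypeLattice.isIsogenous_periodIso_powPeriod`).
[cite: Shimura1998, §6.2 Thm. 3 (proof), pp. 42–44; §6.1 Cor. of Thm. 2, p. 41] -/
theorem isIsogenous_powPeriod_of_inducedCMType_eq_cmTypeOfPair {κ : Type} [Fintype κ] [DecidableEq κ]
    {E : Type} [NormedAddCommGroup E] [NormedSpace ℂ E] [FiniteDimensional ℂ E] {P : (κ → ℝ) ≃L[ℝ] E}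
    {φ : ComplexTorus P → ComplexPoints A.X} (hφ : IsAnalytification E A.X A.dim φ)
    (hadd : ∀ x y, φ (x + y) = φ x * φ y) :
    ComplexTorus.IsIsogenous P
      (ComplexTorus.powPeriod (periodIso Φ₀ (1 : (FractionalIdeal (𝓞 K₀)⁰ K₀)ˣ)) (finrank K₀ F)) :=
  ComplexTorus.IsIsogenous.trans _ _ _ (isIsogenous_periodIso_cmTypeOfPair ιF hF hφ hadd)
    (CMTypeLattice.isIsogenous_periodIso_powPeriod hΦ 1 1)

include hΦ in
/-- **Shimura §6.2 THEOREM 3 with §6.1 COROLLARY, on the algebraic carrier, intrinsic form: `A ∼ B^{[F:K₀]}`.**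
For a complex abelian variety `A` with a field `ι : F → End_ℚ(A)` of degree `2 dim A` whose type
`cmTypeOfPair ιF hF` is induced from a CM type `Φ₀` of a CM subfield `K₀ ≤ F`: `A` is isogenous (both
directions) to the power `B^{[F:K₀]}` of the CM abelian variety of record `B = varietyOfIdeal Φ₀ 1`
(`B^an = ℂ^{Φ₀}/D(𝔬_{K₀})`), and `dim A = [F : K₀] dim B` («`ℂⁿ/D(𝔪)` is complex analytically isomorphic to
the direct product of `h` copies of `ℂ^m/Δ`» + «any two abelian varieties of the same CM-type are
isogenous»). [cite: Shimura1998, §6.2 Thm. 3 (proof), pp. 42–44; §6.1 Cor. of Thm. 2, p. 41] -/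
theorem isIsogenous_powSucc_varietyOfIdeal :
    A.IsIsogenous ((CMTorusRealisation.varietyOfIdeal Φ₀ 1).powSucc (finrank K₀ F - 1)) ∧
      ((CMTorusRealisation.varietyOfIdeal Φ₀ 1).powSucc (finrank K₀ F - 1)).IsIsogenous A ∧
      A.dim = finrank K₀ F * (CMTorusRealisation.varietyOfIdeal Φ₀ 1).dim := by
  obtain ⟨κ, _, _, P, φ, hφ, hadd⟩ := complexAbelianVariety_torusUniformised_holds A
  have h1 : finrank K₀ F = finrank K₀ F - 1 + 1 := (Nat.sub_add_cancel finrank_pos).symm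
  have hiso := isIsogenous_powPeriod_of_inducedCMType_eq_cmTypeOfPair ιF hF hΦ hφ hadd
  rw [h1] at hiso
  have hψ := CMTorusRealisation.isAnalytification_uniformisationOfIdeal Φ₀ (1 : (FractionalIdeal (𝓞 K₀)⁰ K₀)ˣ)
  have hψadd := CMTorusRealisation.uniformisationOfIdeal_add Φ₀ (1 : (FractionalIdeal (𝓞 K₀)⁰ K₀)ˣ)
  refine ⟨(AbelianVariety.isIsogenous_powSucc_iff hψ hψadd hφ hadd _).2 hiso,
    (AbelianVariety.powSucc_isIsogenous_iff hψ hψadd hφ hadd _).2 (ComplexTorus.IsIsogenous.symm _ _ hiso), ?_⟩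
  -- `2 dim A = [F:ℚ] = [K₀:ℚ][F:K₀] = 2 dim B · [F:K₀]`
  have hB := CMTorusRealisation.two_mul_dim_varietyOfIdeal Φ₀ (1 : (FractionalIdeal (𝓞 K₀)⁰ K₀)ˣ)
  have hKK : finrank ℚ K₀ * finrank K₀ F = finrank ℚ F := Module.finrank_mul_finrank ℚ K₀ F
  have h2 : 2 * A.dim = 2 * (finrank K₀ F * (CMTorusRealisation.varietyOfIdeal Φ₀ 1).dim) := by
    rw [← hF, ← hKK, ← hB]; ring
  omega

end InducedType

/-! ### §2 `[K₀ : ℚ] = 2`: `A ∼ E^{dim A}` for a CM elliptic curve, and the Hodge conjecture for `A` -/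

section Quadratic

/-- An imaginary quadratic field — here: a quadratic field carrying a CM type — is a CM field in Mathlib's
sense (`IsCMField.ofCMExtension` over `ℚ`; a CM type makes the field totally complex,
`CMTypeLattice.isTotallyComplex_of_cmType`). [folklore] -/
private theorem isCMField_of_finrank_eq_two (hK₀ : finrank ℚ K₀ = 2) (Φ₀ : CMType K₀) : IsCMField K₀ := by
  haveI : IsTotallyComplex K₀ := CMTypeLattice.isTotallyComplex_of_cmType Φ₀
  haveI : Algebra.IsQuadraticExtension ℚ K₀ := { finrank_eq_two' := hK₀ }
  exact IsCMField.ofCMExtension ℚ K₀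

variable (hK₀ : finrank ℚ K₀ = 2) (hΦ : inducedCMType (algebraMap K₀ F) Φ₀ = cmTypeOfPair ιF hF)

include hK₀ hΦ in
/-- **`A ∼ E^{dim A}` for a CM elliptic curve `E` with `End⁰(E) ≅ K₀`** when THE type of `(A, ι)` is induced
from an IMAGINARY QUADRATIC subfield `K₀ ≤ F`: `E = ℂ/𝔬_{K₀}` (the variety of record of `(K₀; Φ₀)`,
`dim E = [K₀ : ℚ]/2 = 1`, `End⁰(E) ≅ K₀`), and `A ∼ E^{[F:K₀]} = E^{dim A}` by §1.
[cite: Shimura1998, §6.2 Thm. 3 (proof), pp. 42–44; §5.1 Prop. 3, p. 36; §8.4 Example (1)] -/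
theorem exists_ellipticCurve_isIsogenous_powSucc :
    ∃ E : AbelianVariety ℂ, E.dim = 1 ∧ Nonempty (E.endAlgebra ≃ₐ[ℚ] K₀) ∧
      A.IsIsogenous (E.powSucc (A.dim - 1)) ∧ (E.powSucc (A.dim - 1)).IsIsogenous A := by
  haveI : IsCMField K₀ := isCMField_of_finrank_eq_two hK₀ Φ₀
  obtain ⟨hAE, hEA, hdim⟩ := isIsogenous_powSucc_varietyOfIdeal ιF hF hΦ
  have hE1 : (CMTorusRealisation.varietyOfIdeal Φ₀ (1 : (FractionalIdeal (𝓞 K₀)⁰ K₀)ˣ)).dim = 1 :=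
    CMTorusRealisation.dim_varietyOfIdeal_eq_one Φ₀ 1 hK₀
  rw [hE1, mul_one] at hdim
  refine ⟨CMTorusRealisation.varietyOfIdeal Φ₀ 1, hE1,
    CMTorusRealisation.nonempty_endAlgebra_algEquiv_of_finrank_eq_two Φ₀ 1
      (CMTorusRealisation.isAnalytification_uniformisationOfIdeal Φ₀ 1)
      (CMTorusRealisation.uniformisationOfIdeal_add Φ₀ 1) hK₀, ?_, ?_⟩
  · rw [hdim]; exact hAE
  · rw [hdim]; exact hEA

include hK₀ hΦ in
/-- **THE HODGE CONJECTURE for every complex abelian variety `A` whose `End_ℚ(A)` contains a field `F` of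
degree `2 dim A` with type induced from an imaginary quadratic subfield** — in every codimension: such an
`A` is isogenous to a power `E^{dim A}` of a CM elliptic curve (Shimura §6.2 Thm. 3), and the Hodge conjecture
holds for every complex abelian variety isogenous to a power of an elliptic curve (van Geemen Thm. 4.3 with
Lemma 3.7; Tate, Murasaki — the tree's `EllipticCurve.hodgeConjectureFor_of_isIsogenous_powSucc`).  A KNOWN
case; the hypotheses are Shimura's own pair `(A, ι)` and THE intrinsic type `cmTypeOfPair ιF hF`.
[cite: vanGeemen1994HodgeAV, Lemma 3.7 and Thm. 4.3] [cite: Shimura1998, §6.2 Thm. 3 (proof), pp. 42–44]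
[cite: Gordon1997, §3] -/
theorem hodgeConjectureFor_of_inducedCMType_eq_cmTypeOfPair : HodgeConjectureFor A.dim A.X := by
  obtain ⟨E, hE1, -, hAE, -⟩ := exists_ellipticCurve_isIsogenous_powSucc ιF hF hK₀ hΦ
  exact EllipticCurve.hodgeConjectureFor_of_isIsogenous_powSucc hE1 _ hAE

include hK₀ hΦ in
/-- … and for every complex abelian variety isogenous to such an `A` (isogeny invariance, van Geemen
Lemma 3.7, the tree's `HodgeConjectureFor.of_isIsogenous`). [cite: vanGeemen1994HodgeAV, Lemma 3.7 and Thm. 4.3] -/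
theorem hodgeConjectureFor_of_isIsogenous_of_inducedCMType {A' : AbelianVariety ℂ} (hA' : A'.IsIsogenous A) :
    HodgeConjectureFor A'.dim A'.X :=
  HodgeConjectureFor.of_isIsogenous hA' (hodgeConjectureFor_of_inducedCMType_eq_cmTypeOfPair ιF hF hK₀ hΦ)

end Quadratic

/-! ### §3 When is a CM type induced from a quadratic subfield? — the hypothesis of §2 made checkable -/

section Criterion

variable (K₀ : IntermediateField ℚ F)

/-- Every complex embedding of the subfield `K₀` extends to `F` (`ℂ` is algebraically closed). [folklore] -/
private theorem exists_comp_algebraMap_eq (ψ : K₀ →+* ℂ) : ∃ τ : F →+* ℂ, τ.comp (algebraMap K₀ F) = ψ := by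
  letI : Algebra K₀ ℂ := ψ.toAlgebra
  haveI : Module.IsTorsionFree K₀ ℂ := DivisionSemiring.to_moduleIsTorsionFree
  refine ⟨(IsAlgClosed.lift (R := K₀) (M := ℂ) (S := F)).toRingHom, RingHom.ext fun x ↦ ?_⟩
  exact (IsAlgClosed.lift (R := K₀) (M := ℂ) (S := F)).commutes x

omit [NumberField F] in
/-- Outside a CM type lies exactly the conjugate of the type. [folklore] -/
private theorem conjugate_mem_of_not_mem (Φ : CMType F) {τ : F →+* ℂ} (hτ : τ ∉ Φ.1) :
    ComplexEmbedding.conjugate τ ∈ Φ.1 := by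
  rw [Φ.2, (ComplexEmbedding.involutive_conjugate F) τ]
  exact hτ

/-- **A CM type `Φ` of `F` is induced from (a CM type of) a QUADRATIC subfield `K₀ ≤ F` iff all members of `Φ`
restrict to the same embedding of `K₀`** — Shimura's `(K; {ψⱼ})` with `K = K₀` imaginary quadratic and a single
`ψ`: «the `φᵢ` are all the isomorphisms of `F` into `ℂ` inducing the `ψⱼ` on `K`».  (⟹: a CM type of a
quadratic field has one element; ⟸: the common restriction `ψ₀` is not real — else every embedding of `F` would
restrict to `ψ₀`, while `K₀` has two embeddings each extending to `F` — and `Φ = {τ | τ|_{K₀} = ψ₀}`.)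
[cite: Shimura1998, §6.2, p. 43 (the type induced from `(K; {ψⱼ})`); §5.2 Thm. 1 (CM1)–(CM2), p. 40] -/
theorem exists_inducedCMType_eq_iff_forall_comp_eq (hK₀ : finrank ℚ K₀ = 2) (Φ : CMType F) :
    (∃ Φ₀ : CMType K₀, inducedCMType (algebraMap K₀ F) Φ₀ = Φ) ↔
      ∀ φ ∈ Φ.1, ∀ ψ ∈ Φ.1, φ.comp (algebraMap K₀ F) = ψ.comp (algebraMap K₀ F) := by
  constructor
  · rintro ⟨Φ₀, rfl⟩ φ hφ ψ hψ
    rw [mem_inducedCMType_iff] at hφ hψ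
    have hcard : Fintype.card Φ₀.1 = 1 := by
      have h2 := CMTypeLattice.two_mul_card_eq_finrank Φ₀
      simp only [Fintype.card_eq_nat_card] at h2 ⊢
      omega
    obtain ⟨x, hx⟩ := Fintype.card_eq_one_iff.1 hcard
    exact (congrArg Subtype.val (hx ⟨_, hφ⟩)).trans (congrArg Subtype.val (hx ⟨_, hψ⟩)).symm
  · intro h
    -- `Φ` is non-empty (`2 #Φ = [F : ℚ] > 0`)
    have hcard0 : 0 < Fintype.card Φ.1 := by
      have h2 := CMTypeLattice.two_mul_card_eq_finrank Φ
      have hpos : 0 < finrank ℚ F := finrank_pos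
      omega
    obtain ⟨⟨φ₁, hφ₁⟩⟩ := Fintype.card_pos_iff.1 hcard0
    -- every embedding of `F` restricts to `ψ₀ = φ₁|_{K₀}` or to its conjugate
    have hres : ∀ τ : F →+* ℂ, τ.comp (algebraMap K₀ F) = φ₁.comp (algebraMap K₀ F) ∨
        τ.comp (algebraMap K₀ F) = ComplexEmbedding.conjugate (φ₁.comp (algebraMap K₀ F)) := by
      intro τ
      by_cases hτ : τ ∈ Φ.1
      · exact Or.inl (h τ hτ φ₁ hφ₁)
      · right
        have h1 := h _ (conjugate_mem_of_not_mem Φ hτ) φ₁ hφ₁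
        rw [ComplexEmbedding.conjugate_comp] at h1
        rw [← h1, (ComplexEmbedding.involutive_conjugate K₀) _]
    -- `ψ₀` is not real
    have hψ₀ : ComplexEmbedding.conjugate (φ₁.comp (algebraMap K₀ F)) ≠ φ₁.comp (algebraMap K₀ F) := by
      intro hreal
      have hall : ∀ τ : F →+* ℂ, τ.comp (algebraMap K₀ F) = φ₁.comp (algebraMap K₀ F) := fun τ ↦
        (hres τ).elim id fun h' ↦ h'.trans hreal
      have hcard : Fintype.card (K₀ →+* ℂ) = 2 := by rw [NumberField.Embeddings.card, hK₀]
      obtain ⟨ψ₁, hψ₁⟩ : ∃ ψ₁ : K₀ →+* ℂ, ψ₁ ≠ φ₁.comp (algebraMap K₀ F) := by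
        by_contra hno
        push Not at hno
        have h1 : Fintype.card (K₀ →+* ℂ) ≤ 1 :=
          Fintype.card_le_one_iff.2 fun a b ↦ (hno a).trans (hno b).symm
        omega
      obtain ⟨τ, hτ⟩ := exists_comp_algebraMap_eq K₀ ψ₁
      exact hψ₁ (hτ.symm.trans (hall τ))
    -- the two embeddings of `K₀` are `ψ₀` and its conjugate
    have hemb : ∀ ψ : K₀ →+* ℂ, ψ = φ₁.comp (algebraMap K₀ F) ∨
        ψ = ComplexEmbedding.conjugate (φ₁.comp (algebraMap K₀ F)) := by
      intro ψ
      by_contra hno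
      push Not at hno
      have hcard : Fintype.card (K₀ →+* ℂ) = 2 := by rw [NumberField.Embeddings.card, hK₀]
      have h3 := Fintype.two_lt_card_iff.2 ⟨ψ, _, _, hno.1, hno.2, hψ₀.symm⟩
      omega
    -- the CM type `{ψ₀}` of `K₀` induces `Φ`
    refine ⟨⟨{φ₁.comp (algebraMap K₀ F)}, fun ψ ↦ ?_⟩, Subtype.ext (Set.ext fun τ ↦ ?_)⟩
    · rw [Set.mem_singleton_iff, Set.mem_singleton_iff]
      refine ⟨fun hψ ↦ hψ ▸ hψ₀, fun hc ↦ (hemb ψ).elim id fun h' ↦ (hc ?_).elim⟩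
      rw [h', (ComplexEmbedding.involutive_conjugate K₀) _]
    · change τ.comp (algebraMap K₀ F) ∈ ({φ₁.comp (algebraMap K₀ F)} : Set (K₀ →+* ℂ)) ↔ τ ∈ Φ.1
      rw [Set.mem_singleton_iff]
      refine ⟨fun hτ ↦ ?_, fun hτ ↦ h τ hτ φ₁ hφ₁⟩
      by_contra hτΦ
      have h1 := h _ (conjugate_mem_of_not_mem Φ hτΦ) φ₁ hφ₁
      rw [ComplexEmbedding.conjugate_comp, hτ] at h1
      exact hψ₀ h1

/-- **The Hodge conjecture for `(A, ι)` whose type restricts to a single embedding of an imaginary quadratic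
subfield `K₀ ≤ F`** — §2 with the hypothesis in checkable form (§3): all `φ ∈ cmTypeOfPair ιF hF` agree on
`K₀`. [cite: vanGeemen1994HodgeAV, Lemma 3.7 and Thm. 4.3] [cite: Shimura1998, §6.2 Thm. 3 (proof), pp. 42–44] -/
theorem hodgeConjectureFor_of_forall_comp_eq (hK₀ : finrank ℚ K₀ = 2)
    (h : ∀ φ ∈ (cmTypeOfPair ιF hF).1, ∀ ψ ∈ (cmTypeOfPair ιF hF).1,
      φ.comp (algebraMap K₀ F) = ψ.comp (algebraMap K₀ F)) :
    HodgeConjectureFor A.dim A.X := by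
  obtain ⟨Φ₀, hΦ⟩ := (exists_inducedCMType_eq_iff_forall_comp_eq K₀ hK₀ (cmTypeOfPair ιF hF)).2 h
  exact hodgeConjectureFor_of_inducedCMType_eq_cmTypeOfPair ιF hF hK₀ hΦ

end Criterion

end EndFieldFullDegree

end Literature.AlgebraicGeometry.ComplexMultiplication

end
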